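import Literature.Probability.LatticeModels.UrsellFirstZeroBridge
import Literature.Probability.LatticeModels.TruncatedPairFieldCurrents
import HarnessLib

/-!
# Camia–Jiang–Newman 2023, Theorem 2 (PROVED): `CamiaJiangNewman2023_thm2_holds`

Topic `Literature/Probability/LatticeModels`; sibling PROOF file of `UrsellMonotonicity.lean` (named
fact `CamiaJiangNewman2023_thm2`, the Nishimori–Griffiths conjecture: raising a ferromagnetic pair
coupling does not push the first Lee–Yang zero of `⟨exp(hΣλ_jσ_j)⟩` away from the origin).  The printed
proof of Thm 2 rests on CJN Thm 1 (whose printed proof has a gap at eqs. (48)/(60), see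
`UrsellMonotonicityGraphPartitions.lean` and the seat evidence on the work item); this file
machine-checks a DIFFERENT proof (seat evidence `thm2_proof.md`), whose analytic half is
`LeeYangPinnedPhase.lean` / `UrsellFirstZeroPinned.lean` / `UrsellFirstZeroBridge.lean` and whose
combinatorial input is the random-current identity of `TruncatedPairFieldCurrents.lean`:

  (RC)  `S_{uvw}(θ) Z(θ) − N_{uv}(θ) S_w(θ) = Σ_{K,a} κ_{K,a} · S^{K}_a(θ) · Z_K(θ)`,  `κ ≥ 0` independent of `θ`,

the random-current representation of the truncated correlation `⟨σ_uσ_v ; σ_w⟩` at the imaginary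
fields `iθλ` (switching lemma with imaginary ghost couplings + cluster decomposition; `K` ranges over
the complements of the cluster of `w`, i.e. over INDUCED SUB-MODELS `cSub K c`, `lamSub K λ` on the
same index type), implies CJN Thm 2:

* `avg_spin_pair_cos_nonpos_of_pairDec` — **PAIR-DEC′ ⇒ NG′**: if `S_{uvw}Z − N_{uv}S_w ≥ 0` for all
  `w` on `[0,θ⋆)` then `⟨σ_uσ_v cos θ⋆X⟩ ≤ 0` at the first zero `θ⋆` (`N/Z` is non-increasing, and
  would blow up if `N(θ⋆) > 0`).
* `posUpTo_of_raise`, `pos_zeroOn_of_ng`, `pos_of_isolated_drop(_set)`, `pos_sub_of_ng` — **the first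
  zero of an induced sub-model is not earlier**, given NG′ for all models with fewer nonzero
  entries (edge deletion = the single-coupling step of `UrsellFirstZeroBridge.lean` read backwards +
  Lee–Yang; isolated sites factor off by `sum_mul_sum_eq_of_decoupled`).
* `ng_all_of_rc` — **NG′ for every model and pair from (RC)**, by strong induction on the number of
  nonzero coupling entries: each term of (RC) is `≥ 0` on `[0, a₁(sub-model)) ⊇ [0, a₁(model))` by
  `sum_spin_mul_sin_weight_nonneg` (`LeeYangPinnedPhase.lean`).
* `CamiaJiangNewman2023_thm2_of_rc` — **(RC) for all finite models ⇒ `CamiaJiangNewman2023_thm2`**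
  (via `CamiaJiangNewman2023_thm2_of_pinnedSign`).
* `CamiaJiangNewman2023_thm2_holds` — **the named fact, discharged**: (RC) is
  `PairIsing.rc_imaginary_field` (`TruncatedPairFieldCurrents.lean`: switching lemma with Griffiths'
  ghost vertex at real fields `h ≥ 0`, conditioning on the cluster of `w`, analytic continuation to
  `h = iθλ`).

Definitions: `nnz` (number of nonzero entries), `zeroOn` (the induced sub-model `cSub`, `lamSub` is in
`TruncatedPairFieldCurrents.lean`).  No named facts; the trust base of `CamiaJiangNewman2023_thm2_holds`
is Mathlib (axioms `propext`, `Classical.choice`, `Quot.sound`).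

## References

* [CamiaJiangNewman2023] F. Camia, J. Jiang, C. M. Newman, CMP 401 (2023), arXiv:2207.12247, Thm 2
  (statement; the proof formalized here is not the printed one).
* [DuminilCopin2016] H. Duminil-Copin, arXiv:1607.06933, §2–§3 (ghost vertex, switching lemma);
  [AizenmanCMP1982] M. Aizenman, Comm. Math. Phys. 86 (1982), §5 (conditioning on clusters);
  R. B. Griffiths, C. A. Hurst, S. Sherman, J. Math. Phys. 11 (1970) 790.
* [Newman1975] C. M. Newman, CMP 41 (1975), Thm 1; [LiebSokal1981] §3 (Lee–Yang inputs).
-/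

noncomputable section

open Finset Complex

namespace Literature.Probability.LatticeModels

namespace PairIsing

section PairDec

variable {ι : Type*} [Fintype ι] [DecidableEq ι]

/-- Regrouping `Σ_ρ F(ρ) X(ρ) = Σ_x λ_x Σ_ρ σ_x(ρ) F(ρ)`. [folklore] -/
theorem sum_mul_weightedMagnetization (lam : ι → ℝ) (F : SpinConfig ι → ℝ) :
    (∑ ρ : SpinConfig ι, F ρ * weightedMagnetization lam ρ) =
      ∑ x, lam x * ∑ ρ : SpinConfig ι, spinAt x ρ * F ρ := by
  unfold weightedMagnetization
  simp_rw [Finset.mul_sum]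
  rw [Finset.sum_comm]
  refine sum_congr rfl fun x _ => ?_
  refine sum_congr rfl fun ρ _ => ?_
  ring

/-- `θ`-derivative of `Σ σ_uσ_v cos(θX) w`: `-Σ_x λ_x Σ σ_uσ_vσ_x sin(θX) w`. [folklore] -/
theorem hasDerivAt_sum_pair_cos (c : ι → ι → ℝ) (lam : ι → ℝ) (u v : ι) (θ : ℝ) :
    HasDerivAt (fun θ' : ℝ => ∑ ρ : SpinConfig ι,
        spinAt u ρ * spinAt v ρ * Real.cos (θ' * weightedMagnetization lam ρ) * weight c ρ)
      (-∑ x, lam x * ∑ ρ : SpinConfig ι, spinAt x ρ * (spinAt u ρ * spinAt v ρ *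
        Real.sin (θ * weightedMagnetization lam ρ) * weight c ρ)) θ := by
  have h : HasDerivAt (fun θ' : ℝ => ∑ ρ : SpinConfig ι,
        spinAt u ρ * spinAt v ρ * Real.cos (θ' * weightedMagnetization lam ρ) * weight c ρ)
      (∑ ρ : SpinConfig ι, -(spinAt u ρ * spinAt v ρ *
        Real.sin (θ * weightedMagnetization lam ρ) * weight c ρ) * weightedMagnetization lam ρ) θ := by
    refine HasDerivAt.fun_sum fun ρ _ => ?_
    have h1 := ((Real.hasDerivAt_cos (θ * weightedMagnetization lam ρ)).comp θ
      ((hasDerivAt_id θ).mul_const (weightedMagnetization lam ρ)))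
    have h2 := (h1.const_mul (spinAt u ρ * spinAt v ρ)).mul_const (weight c ρ)
    refine h2.congr_deriv ?_
    ring
  refine h.congr_deriv ?_
  rw [← sum_mul_weightedMagnetization lam, ← Finset.sum_neg_distrib]
  exact sum_congr rfl fun ρ _ => by ring

/-- `θ`-derivative of `Σ cos(θX) w`: `-Σ_x λ_x Σ σ_x sin(θX) w`. [folklore] -/
theorem hasDerivAt_sum_cos (c : ι → ι → ℝ) (lam : ι → ℝ) (θ : ℝ) :
    HasDerivAt (fun θ' : ℝ => ∑ ρ : SpinConfig ι,
        Real.cos (θ' * weightedMagnetization lam ρ) * weight c ρ)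
      (-∑ x, lam x * ∑ ρ : SpinConfig ι, spinAt x ρ *
        (Real.sin (θ * weightedMagnetization lam ρ) * weight c ρ)) θ := by
  have h : HasDerivAt (fun θ' : ℝ => ∑ ρ : SpinConfig ι,
        Real.cos (θ' * weightedMagnetization lam ρ) * weight c ρ)
      (∑ ρ : SpinConfig ι,
        -(Real.sin (θ * weightedMagnetization lam ρ) * weight c ρ) * weightedMagnetization lam ρ) θ := by
    refine HasDerivAt.fun_sum fun ρ _ => ?_
    have h1 := ((Real.hasDerivAt_cos (θ * weightedMagnetization lam ρ)).comp θ
      ((hasDerivAt_id θ).mul_const (weightedMagnetization lam ρ)))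
    have h2 := h1.mul_const (weight c ρ)
    refine h2.congr_deriv ?_
    ring
  refine h.congr_deriv ?_
  rw [← sum_mul_weightedMagnetization lam, ← Finset.sum_neg_distrib]
  exact sum_congr rfl fun ρ _ => by ring

/-- **PAIR-DEC′ ⇒ NG′** (the pinned-sign inequality at the first zero from the pair-decrease
inequalities): if `S_{uvw} Z - N_{uv} S_w ≥ 0` for all sites `w` on `[0, θ⋆)` (with `λ ≥ 0`),
`⟨cos θX⟩_c > 0` on `[0, θ⋆)` and `⟨cos θ⋆X⟩_c = 0`, then `⟨σ_uσ_v cos θ⋆X⟩_c ≤ 0`: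
`N/Z` is non-increasing on `[0,θ⋆)` (its derivative is `-Σ_w λ_w (S_{uvw}Z - N S_w)/Z²`), bounded
by its value at `0`, while `N(θ⋆) > 0` would force `N/Z → +∞`. [folklore] -/
theorem avg_spin_pair_cos_nonpos_of_pairDec {c : ι → ι → ℝ} {lam : ι → ℝ} (hlam : ∀ x, 0 ≤ lam x)
    {u v : ι} {θs : ℝ} (hθs : 0 < θs)
    (hPD : ∀ (x : ι) (θ : ℝ), 0 ≤ θ → θ < θs →
      0 ≤ (∑ ρ : SpinConfig ι, spinAt u ρ * spinAt v ρ * spinAt x ρ *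
              Real.sin (θ * weightedMagnetization lam ρ) * weight c ρ) *
            (∑ ρ : SpinConfig ι, Real.cos (θ * weightedMagnetization lam ρ) * weight c ρ) -
          (∑ ρ : SpinConfig ι, spinAt u ρ * spinAt v ρ *
              Real.cos (θ * weightedMagnetization lam ρ) * weight c ρ) *
            (∑ ρ : SpinConfig ι, spinAt x ρ * Real.sin (θ * weightedMagnetization lam ρ) * weight c ρ))
    (hposb : ∀ θ' ∈ Set.Ico (0 : ℝ) θs,
      0 < avg c (fun ρ => Real.cos (θ' * weightedMagnetization lam ρ)))
    (hzs : avg c (fun ρ => Real.cos (θs * weightedMagnetization lam ρ)) = 0) :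
    avg c (fun ρ => spinAt u ρ * spinAt v ρ * Real.cos (θs * weightedMagnetization lam ρ)) ≤ 0 := by
  set Z : ℝ → ℝ := fun θ => ∑ ρ : SpinConfig ι, Real.cos (θ * weightedMagnetization lam ρ) * weight c ρ
    with hZ
  set N : ℝ → ℝ := fun θ => ∑ ρ : SpinConfig ι,
    spinAt u ρ * spinAt v ρ * Real.cos (θ * weightedMagnetization lam ρ) * weight c ρ with hN
  set S : ι → ℝ → ℝ := fun x θ => ∑ ρ : SpinConfig ι,
    spinAt x ρ * (Real.sin (θ * weightedMagnetization lam ρ) * weight c ρ) with hS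
  set S3 : ι → ℝ → ℝ := fun x θ => ∑ ρ : SpinConfig ι, spinAt x ρ * (spinAt u ρ * spinAt v ρ *
    Real.sin (θ * weightedMagnetization lam ρ) * weight c ρ) with hS3
  -- the hypothesis in terms of `S`, `S3`
  have hPD' : ∀ x t, 0 ≤ t → t < θs → 0 ≤ S3 x t * Z t - N t * S x t := by
    intro x t ht0 ht1
    have h := hPD x t ht0 ht1
    have e1 : S3 x t = ∑ ρ : SpinConfig ι, spinAt u ρ * spinAt v ρ * spinAt x ρ *
        Real.sin (t * weightedMagnetization lam ρ) * weight c ρ :=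
      sum_congr rfl fun ρ _ => by ring
    have e2 : S x t = ∑ ρ : SpinConfig ι,
        spinAt x ρ * Real.sin (t * weightedMagnetization lam ρ) * weight c ρ :=
      sum_congr rfl fun ρ _ => by ring
    rw [e1, e2]
    exact h
  have hW : 0 < ∑ ρ : SpinConfig ι, weight c ρ := sum_weight_pos c
  have hZpos : ∀ θ ∈ Set.Ico (0 : ℝ) θs, 0 < Z θ := by
    intro θ hθ
    have h1 := hposb θ hθ
    rw [avg_def] at h1
    exact (div_pos_iff_of_pos_right hW).1 h1
  have hZs : Z θs = 0 := by
    rw [avg_def, div_eq_zero_iff] at hzs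
    exact hzs.resolve_right hW.ne'
  have hZd : ∀ θ, HasDerivAt Z (-∑ x, lam x * S x θ) θ := fun θ => hasDerivAt_sum_cos c lam θ
  have hNd : ∀ θ, HasDerivAt N (-∑ x, lam x * S3 x θ) θ := fun θ => hasDerivAt_sum_pair_cos c lam u v θ
  have hZc : Continuous Z := continuous_iff_continuousAt.2 fun θ => (hZd θ).continuousAt
  have hNc : Continuous N := continuous_iff_continuousAt.2 fun θ => (hNd θ).continuousAt
  -- `q = N/Z` is antitone on `[0, θ₁]` for every `θ₁ < θs`
  set q : ℝ → ℝ := fun θ => N θ / Z θ with hq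
  have hanti : ∀ θ₁, θ₁ < θs → ∀ θ ∈ Set.Icc (0 : ℝ) θ₁, q θ ≤ q 0 := by
    intro θ₁ hθ₁ θ hθ
    have hqd : ∀ t ∈ Set.Icc (0 : ℝ) θ₁,
        HasDerivAt q (((-∑ x, lam x * S3 x t) * Z t - N t * (-∑ x, lam x * S x t)) / (Z t) ^ 2) t :=
      fun t ht => (hNd t).div (hZd t) (hZpos t ⟨ht.1, ht.2.trans_lt hθ₁⟩).ne'
    have hmono : AntitoneOn q (Set.Icc 0 θ₁) := by
      refine antitoneOn_of_deriv_nonpos (convex_Icc 0 θ₁) ?_ ?_ ?_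
      · exact fun t ht => (hqd t ht).continuousAt.continuousWithinAt
      · intro t ht
        exact (hqd t (interior_subset ht)).differentiableAt.differentiableWithinAt
      · intro t ht
        have ht' : t ∈ Set.Icc (0 : ℝ) θ₁ := interior_subset ht
        rw [(hqd t ht').deriv]
        refine div_nonpos_iff.2 (Or.inr ⟨?_, sq_nonneg _⟩)
        -- numerator `= -Σ_x λ_x (S3_x Z - N S_x) ≤ 0`
        have hx : ∀ x, 0 ≤ lam x * (S3 x t * Z t - N t * S x t) := fun x =>
          mul_nonneg (hlam x) (hPD' x t ht'.1 (ht'.2.trans_lt hθ₁))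
        have hsum : 0 ≤ ∑ x, lam x * (S3 x t * Z t - N t * S x t) := sum_nonneg fun x _ => hx x
        have hAB : (∑ x, lam x * S3 x t) * Z t - N t * (∑ x, lam x * S x t) =
            ∑ x, lam x * (S3 x t * Z t - N t * S x t) := by
          rw [Finset.sum_mul, Finset.mul_sum, ← Finset.sum_sub_distrib]
          exact sum_congr rfl fun x _ => by ring
        have : (-∑ x, lam x * S3 x t) * Z t - N t * (-∑ x, lam x * S x t) =
            -((∑ x, lam x * S3 x t) * Z t - N t * (∑ x, lam x * S x t)) := by ring
        rw [this, hAB]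
        linarith
    exact hmono (Set.left_mem_Icc.2 (hθ.1.trans hθ.2)) hθ hθ.1
  -- suppose `N(θs) > 0` and derive a contradiction
  by_contra hcon
  rw [avg_def, not_le] at hcon
  have hNs : 0 < N θs := by
    have := (div_pos_iff_of_pos_right hW).1 hcon
    exact this
  -- near `θs`: `N > N θs / 2` and `Z < ε`
  set q0 : ℝ := q 0 with hq0
  set ε : ℝ := N θs / (2 * (|q0| + 1)) with hε
  have hεpos : 0 < ε := by
    rw [hε]; positivity
  have hNev : ∀ᶠ θ in nhds θs, N θs / 2 < N θ := by
    have := hNc.continuousAt.eventually (lt_mem_nhds (show N θs / 2 < N θs by linarith))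
    exact this
  have hZev : ∀ᶠ θ in nhds θs, Z θ < ε := by
    have h1 : Z θs < ε := by rw [hZs]; exact hεpos
    exact hZc.continuousAt.eventually (gt_mem_nhds h1)
  have hev : ∀ᶠ θ in nhdsWithin θs (Set.Iio θs), N θs / 2 < N θ ∧ Z θ < ε ∧ θ ∈ Set.Ioo 0 θs := by
    have h12 : ∀ᶠ θ in nhdsWithin θs (Set.Iio θs), N θs / 2 < N θ ∧ Z θ < ε :=
      nhdsWithin_le_nhds (hNev.and hZev)
    have h3 : ∀ᶠ θ in nhdsWithin θs (Set.Iio θs), θ ∈ Set.Ioo 0 θs := Ioo_mem_nhdsLT hθs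
    exact h12.and h3 |>.mono fun θ h => ⟨h.1.1, h.1.2, h.2⟩
  obtain ⟨θ₁, hN1, hZ1, hθ₁⟩ := hev.exists
  have hZ1pos : 0 < Z θ₁ := hZpos θ₁ ⟨hθ₁.1.le, hθ₁.2⟩
  -- `q θ₁ = N θ₁ / Z θ₁ > (N θs/2)/ε = |q0| + 1 > q0`
  have hq1 : |q0| + 1 < q θ₁ := by
    simp only [hq]
    rw [lt_div_iff₀ hZ1pos]
    calc (|q0| + 1) * Z θ₁ < (|q0| + 1) * ε := by
          exact mul_lt_mul_of_pos_left hZ1 (by positivity)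
      _ = N θs / 2 := by rw [hε]; field_simp
      _ < N θ₁ := hN1
  have hq1' : q θ₁ ≤ q0 := hanti θ₁ hθ₁.2 θ₁ ⟨hθ₁.1.le, le_rfl⟩
  have : q0 ≤ |q0| := le_abs_self q0
  linarith

end PairDec

/-! ### R5. From the random-current identity (RC) to CJN Theorem 2 -/



section Assembly

variable {ι : Type} [Fintype ι] [DecidableEq ι]

/-- **Edge deletion preserves positivity.** If NG′ holds for `c'` at `(a,b)` and `c'` with the
`(a,b)` entry raised by `δ ≥ 0` has `⟨cos θX⟩ > 0` on `[0,T)`, then so has `c'` (a zero of the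
`c'`-model below `T` would produce one of the raised model below `T`, by the single-coupling step
and Lee–Yang). [folklore] -/
theorem posUpTo_of_raise {c' : ι → ι → ℝ} (hc' : ∀ a b, 0 ≤ c' a b) {lam : ι → ℝ}
    (hlam : ∀ a, 0 ≤ lam a) {a b : ι}
    (hNG : ∀ θ : ℝ, 0 < θ →
      (∀ θ' ∈ Set.Ico (0 : ℝ) θ, 0 < avg c' (fun ρ => Real.cos (θ' * weightedMagnetization lam ρ))) →
      avg c' (fun ρ => Real.cos (θ * weightedMagnetization lam ρ)) = 0 →
      avg c' (fun ρ => spinAt a ρ * spinAt b ρ * Real.cos (θ * weightedMagnetization lam ρ)) ≤ 0)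
    {δ : ℝ} (hδ : 0 ≤ δ) {T : ℝ}
    (hpos : ∀ θ ∈ Set.Ico (0 : ℝ) T,
      0 < avg (setCoupling c' a b (c' a b + δ)) (fun ρ => Real.cos (θ * weightedMagnetization lam ρ))) :
    ∀ θ ∈ Set.Ico (0 : ℝ) T, 0 < avg c' (fun ρ => Real.cos (θ * weightedMagnetization lam ρ)) := by
  intro θ hθ
  by_contra hneg
  push Not at hneg
  set g : ℝ → ℝ := fun t => avg c' (fun ρ => Real.cos (t * weightedMagnetization lam ρ)) with hg
  have hcont : Continuous g := continuous_avg_cos c' lam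
  have hg0 : g 0 = 1 := avg_cos_zero c' lam
  have hivt : (0 : ℝ) ∈ g '' Set.Icc 0 θ := by
    have hsub := intermediate_value_Icc' hθ.1 hcont.continuousOn
    exact hsub ⟨hneg, by rw [hg0]; exact zero_le_one⟩
  obtain ⟨t₀, ht₀, hgt₀⟩ := hivt
  have hz : mgf c' lam ((t₀ : ℂ) * Complex.I) = 0 := by
    rw [mgf_mul_I]; exact_mod_cast hgt₀
  obtain ⟨h', hz', hle⟩ := exists_zero_le_of_raise_of_pinnedSign hNG hc' hlam hδ hz
  have hcnn : ∀ x y, 0 ≤ setCoupling c' a b (c' a b + δ) x y := by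
    intro x y; unfold setCoupling; split_ifs
    · exact add_nonneg (hc' a b) hδ
    · exact hc' x y
  obtain ⟨t₁, ht₁pos, ht₁le, ht₁z⟩ := PairIsing.exists_cos_zero_of_mgf_eq_zero hcnn hlam hz'
  have hnorm : ‖(t₀ : ℂ) * Complex.I‖ = t₀ := by
    rw [norm_mul, Complex.norm_I, mul_one, Complex.norm_real, Real.norm_eq_abs, abs_of_nonneg ht₀.1]
  have ht₁T : t₁ < T := by
    calc t₁ ≤ ‖h'‖ := ht₁le
      _ ≤ t₀ := by rw [← hnorm]; exact hle
      _ ≤ θ := ht₀.2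
      _ < T := hθ.2
  have := hpos t₁ ⟨ht₁pos.le, ht₁T⟩
  rw [ht₁z] at this
  exact lt_irrefl _ this

/-- **Dropping the weight of an isolated site preserves positivity** of `⟨cos θX⟩` on `[0,T)`:
`⟨cos θX⟩ = ⟨cos θX'⟩ · cos(θλ_x)` for `x` isolated (`X' = X - λ_xσ_x`), so `⟨cos θX'⟩` cannot
vanish on `[0,T)` and is positive there. [folklore] -/
theorem pos_of_isolated_drop {c : ι → ι → ℝ} {lam : ι → ℝ} (x : ι)
    (hiso : ∀ y, c x y = 0 ∧ c y x = 0) {T : ℝ}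
    (hpos : ∀ θ ∈ Set.Ico (0 : ℝ) T, 0 < avg c (fun ρ => Real.cos (θ * weightedMagnetization lam ρ))) :
    ∀ θ ∈ Set.Ico (0 : ℝ) T,
      0 < avg c (fun ρ => Real.cos (θ * weightedMagnetization (Function.update lam x 0) ρ)) := by
  classical
  set lam' := Function.update lam x 0 with hlam'
  -- `X = X' + λ_x σ_x`
  have hX : ∀ ρ : SpinConfig ι, weightedMagnetization lam ρ =
      weightedMagnetization lam' ρ + lam x * spinAt x ρ := by
    intro ρ
    unfold weightedMagnetization
    have h1 : (∑ u, lam' u * spinAt u ρ) = ∑ u, lam u * spinAt u ρ - lam x * spinAt x ρ := by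
      have : (∑ u, lam u * spinAt u ρ) - ∑ u, lam' u * spinAt u ρ = lam x * spinAt x ρ := by
        rw [← sum_sub_distrib, Finset.sum_eq_single x]
        · simp [hlam']
        · intro y _ hyx; simp [hlam', Function.update_of_ne hyx]
        · intro hx; exact absurd (mem_univ x) hx
      linarith
    rw [h1]; ring
  -- the factorisation `Σ cos(θX) w = cos(θλ_x) Σ cos(θX') w` (the cross term vanishes by independence)
  have hdec : ∀ p q, p ∈ ({x}ᶜ : Finset ι) → q ∉ ({x}ᶜ : Finset ι) → c p q = 0 ∧ c q p = 0 := by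
    intro p q _ hq
    have hq' : q = x := by simpa using hq
    subst hq'
    exact ⟨(hiso p).2, (hiso p).1⟩
  have hfac : ∀ θ, (∑ ρ : SpinConfig ι, Real.cos (θ * weightedMagnetization lam ρ) * weight c ρ) =
      Real.cos (θ * lam x) * ∑ ρ : SpinConfig ι, Real.cos (θ * weightedMagnetization lam' ρ) * weight c ρ := by
    intro θ
    have hcosx : ∀ ρ : SpinConfig ι, Real.cos (θ * (lam x * spinAt x ρ)) = Real.cos (θ * lam x) := by
      intro ρ
      rcases spinAt_eq_one_or_eq_neg_one x ρ with h | h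
      · rw [h, mul_one]
      · rw [h, mul_neg_one, mul_neg, Real.cos_neg]
    have hsinx : ∀ ρ : SpinConfig ι, Real.sin (θ * (lam x * spinAt x ρ)) = spinAt x ρ * Real.sin (θ * lam x) := by
      intro ρ
      rcases spinAt_eq_one_or_eq_neg_one x ρ with h | h
      · rw [h, mul_one, one_mul]
      · rw [h, mul_neg_one, mul_neg, Real.sin_neg, neg_one_mul]
    -- independence: `Σ sin(θX') σ_x w · Σ w = Σ sin(θX') w · Σ σ_x w = 0`
    have hind := sum_mul_sum_eq_of_decoupled ({x}ᶜ : Finset ι) hdec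
      (fun ρ => Real.sin (θ * weightedMagnetization lam' ρ)) (fun ρ => spinAt x ρ)
      (fun ρ ρ' => by
        congr 1; congr 1
        unfold weightedMagnetization
        refine sum_congr rfl fun y _ => ?_
        by_cases hy : y = x
        · subst hy; simp [hlam']
        · have : y ∈ ({x}ᶜ : Finset ι) := by simp [hy]
          simp [spinAt, this])
      (fun ρ ρ' => by simp [spinAt])
    have hodd : (∑ ρ : SpinConfig ι, spinAt x ρ * weight c ρ) = 0 := by
      have := sum_spin_mul_cos_weight_eq_zero c lam x 0
      simpa using this
    rw [hodd, mul_zero] at hind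
    have hW : (∑ ρ : SpinConfig ι, weight c ρ) ≠ 0 := (sum_weight_pos c).ne'
    have hcross : (∑ ρ : SpinConfig ι, Real.sin (θ * weightedMagnetization lam' ρ) * spinAt x ρ * weight c ρ) = 0 := by
      rcases mul_eq_zero.1 hind with h | h
      · exact h
      · exact absurd h hW
    calc (∑ ρ : SpinConfig ι, Real.cos (θ * weightedMagnetization lam ρ) * weight c ρ)
        = ∑ ρ : SpinConfig ι, (Real.cos (θ * lam x) * (Real.cos (θ * weightedMagnetization lam' ρ) * weight c ρ)
            - Real.sin (θ * lam x) * (Real.sin (θ * weightedMagnetization lam' ρ) * spinAt x ρ * weight c ρ)) := by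
          refine sum_congr rfl fun ρ _ => ?_
          rw [hX ρ, mul_add, Real.cos_add, hcosx, hsinx]; ring
      _ = Real.cos (θ * lam x) * ∑ ρ : SpinConfig ι, Real.cos (θ * weightedMagnetization lam' ρ) * weight c ρ := by
          rw [sum_sub_distrib, ← mul_sum, ← mul_sum, hcross, mul_zero, sub_zero]
  -- conclude by the IVT: `⟨cos θX'⟩` does not vanish on `[0,T)` and equals `1` at `0`
  intro θ hθ
  have hW : 0 < ∑ ρ : SpinConfig ι, weight c ρ := sum_weight_pos c
  have hne : ∀ t ∈ Set.Icc (0 : ℝ) θ, avg c (fun ρ => Real.cos (t * weightedMagnetization lam' ρ)) ≠ 0 := by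
    intro t ht h0
    have hpt := hpos t ⟨ht.1, ht.2.trans_lt hθ.2⟩
    rw [avg_def, hfac t] at hpt
    rw [avg_def, div_eq_zero_iff] at h0
    rcases h0 with h0 | h0
    · rw [h0, mul_zero, zero_div] at hpt; exact lt_irrefl _ hpt
    · exact hW.ne' h0
  by_contra hneg
  push Not at hneg
  have hcont : Continuous fun t : ℝ => avg c (fun ρ => Real.cos (t * weightedMagnetization lam' ρ)) :=
    continuous_avg_cos c lam'
  have hivt : (0 : ℝ) ∈ (fun t : ℝ => avg c (fun ρ => Real.cos (t * weightedMagnetization lam' ρ))) '' Set.Icc 0 θ := by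
    have hsub := intermediate_value_Icc' hθ.1 hcont.continuousOn
    refine hsub ⟨hneg, ?_⟩
    show (0 : ℝ) ≤ avg c (fun ρ => Real.cos (0 * weightedMagnetization lam' ρ))
    rw [avg_cos_zero]; exact zero_le_one
  obtain ⟨t, ht, ht0⟩ := hivt
  exact hne t ht ht0

/-- Zeroing the couplings at a set of sites and dropping their weights preserves positivity of
`⟨cos θX⟩` on `[0,T)`, GIVEN NG′ for all models with fewer nonzero entries (edge deletion) —
the weights are dropped one isolated site at a time. Here: the weight-dropping half, for sites
that are already isolated. [folklore] -/
theorem pos_of_isolated_drop_set {c : ι → ι → ℝ} {lam : ι → ℝ} (D : Finset ι)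
    (hiso : ∀ x ∈ D, ∀ y, c x y = 0 ∧ c y x = 0) {T : ℝ}
    (hpos : ∀ θ ∈ Set.Ico (0 : ℝ) T, 0 < avg c (fun ρ => Real.cos (θ * weightedMagnetization lam ρ))) :
    ∀ θ ∈ Set.Ico (0 : ℝ) T,
      0 < avg c (fun ρ => Real.cos (θ * weightedMagnetization (fun a => if a ∈ D then 0 else lam a) ρ)) := by
  classical
  induction D using Finset.induction_on generalizing lam with
  | empty => simpa using hpos
  | insert x D hxD ih =>
    have hisoD : ∀ x ∈ D, ∀ y, c x y = 0 ∧ c y x = 0 := fun y hy => hiso y (mem_insert_of_mem hy)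
    have h1 := ih hisoD hpos
    have h2 := pos_of_isolated_drop x (hiso x (mem_insert_self x D)) h1
    have heq : (Function.update (fun a => if a ∈ D then 0 else lam a) x 0) =
        fun a => if a ∈ insert x D then 0 else lam a := by
      funext a
      by_cases hax : a = x
      · subst hax; simp
      · rw [Function.update_of_ne hax]; simp [hax]
    rw [heq] at h2
    exact h2

end Assembly

section Assembly2

variable {ι : Type} [Fintype ι] [DecidableEq ι]

/-- Number of nonzero coupling entries (the induction measure). [folklore] -/
def nnz (c : ι → ι → ℝ) : ℕ := ((univ : Finset (ι × ι)).filter fun p => c p.1 p.2 ≠ 0).card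

/-- Zeroing a set of entries. [folklore] -/
def zeroOn (Q : Finset (ι × ι)) (c : ι → ι → ℝ) : ι → ι → ℝ :=
  fun a b => if (a, b) ∈ Q then 0 else c a b

omit [Fintype ι] in
/-- `zeroOn Q c ≥ 0` for `c ≥ 0`. [folklore] -/
theorem zeroOn_nonneg (Q : Finset (ι × ι)) {c : ι → ι → ℝ} (hc : ∀ a b, 0 ≤ c a b) (a b : ι) :
    0 ≤ zeroOn Q c a b := by
  unfold zeroOn; split_ifs; exacts [le_rfl, hc a b]

omit [Fintype ι] in
/-- Zeroing one entry fewer = raising that entry back (`setCoupling`). [folklore] -/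
theorem zeroOn_insert_eq_setCoupling (Q : Finset (ι × ι)) (c : ι → ι → ℝ) (p : ι × ι) :
    zeroOn Q c = setCoupling (zeroOn (insert p Q) c) p.1 p.2
      (zeroOn (insert p Q) c p.1 p.2 + zeroOn Q c p.1 p.2) := by
  funext a b
  unfold setCoupling zeroOn
  by_cases hab : a = p.1 ∧ b = p.2
  · obtain ⟨rfl, rfl⟩ := hab
    simp
  · rw [if_neg hab]
    have hne : (a, b) ≠ p := fun h => hab ⟨by rw [← h], by rw [← h]⟩
    simp [Finset.mem_insert, hne]

/-- Zeroing a nonzero entry lowers `nnz`. [folklore] -/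
theorem nnz_zeroOn_insert_lt {Q : Finset (ι × ι)} {c : ι → ι → ℝ} {p : ι × ι}
    (hp : c p.1 p.2 ≠ 0) : nnz (zeroOn (insert p Q) c) < nnz c := by
  unfold nnz
  refine card_lt_card ⟨fun q hq => ?_, fun hsub => ?_⟩
  · rw [mem_filter] at hq ⊢
    refine ⟨mem_univ _, ?_⟩
    have h := hq.2
    unfold zeroOn at h
    split_ifs at h with hmem
    · exact absurd rfl h
    · exact h
  · have hpin : p ∈ (univ : Finset (ι × ι)).filter (fun q => c q.1 q.2 ≠ 0) :=
      mem_filter.2 ⟨mem_univ _, hp⟩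
    have := hsub hpin
    rw [mem_filter] at this
    exact this.2 (by unfold zeroOn; simp)

/-- Zeroing entries does not raise `nnz`. [folklore] -/
theorem nnz_zeroOn_le (Q : Finset (ι × ι)) (c : ι → ι → ℝ) : nnz (zeroOn Q c) ≤ nnz c := by
  unfold nnz
  refine card_le_card fun q hq => ?_
  rw [mem_filter] at hq ⊢
  refine ⟨mem_univ _, ?_⟩
  have h := hq.2
  unfold zeroOn at h
  split_ifs at h
  · exact absurd rfl h
  · exact h

/-- `cSub K c` is `c` with all entries not in `K × K` zeroed. [folklore] -/
theorem cSub_eq_zeroOn (K : Finset ι) (c : ι → ι → ℝ) :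
    cSub K c = zeroOn ((univ : Finset (ι × ι)).filter fun p => ¬(p.1 ∈ K ∧ p.2 ∈ K)) c := by
  funext a b
  unfold cSub zeroOn
  by_cases h : a ∈ K ∧ b ∈ K
  · rw [if_pos h, if_neg]; simp [h]
  · rw [if_neg h, if_pos]; simp only [mem_filter, mem_univ, true_and]; exact h

/-- **Zeroing entries preserves positivity, given NG′ below.** If NG′ holds for every pair in every
model with fewer nonzero entries than `c`, then `⟨cos θX⟩_c > 0` on `[0,T)` implies the same for
`zeroOn Q c`, for every set `Q` of entries. [folklore] -/
theorem pos_zeroOn_of_ng {c : ι → ι → ℝ} (hc : ∀ a b, 0 ≤ c a b) {lam : ι → ℝ} (hlam : ∀ a, 0 ≤ lam a)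
    (hIH : ∀ c'' : ι → ι → ℝ, (∀ a b, 0 ≤ c'' a b) → nnz c'' < nnz c → ∀ a b : ι,
      ∀ θ : ℝ, 0 < θ →
        (∀ θ' ∈ Set.Ico (0 : ℝ) θ, 0 < avg c'' (fun ρ => Real.cos (θ' * weightedMagnetization lam ρ))) →
        avg c'' (fun ρ => Real.cos (θ * weightedMagnetization lam ρ)) = 0 →
        avg c'' (fun ρ => spinAt a ρ * spinAt b ρ * Real.cos (θ * weightedMagnetization lam ρ)) ≤ 0)
    {T : ℝ} (hpos : ∀ θ ∈ Set.Ico (0 : ℝ) T, 0 < avg c (fun ρ => Real.cos (θ * weightedMagnetization lam ρ)))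
    (Q : Finset (ι × ι)) :
    ∀ θ ∈ Set.Ico (0 : ℝ) T, 0 < avg (zeroOn Q c) (fun ρ => Real.cos (θ * weightedMagnetization lam ρ)) := by
  classical
  induction Q using Finset.induction_on with
  | empty =>
    have : zeroOn (∅ : Finset (ι × ι)) c = c := by funext a b; simp [zeroOn]
    rw [this]; exact hpos
  | insert p Q hpQ ih =>
    by_cases hcp : c p.1 p.2 = 0
    · -- nothing changes
      have : zeroOn (insert p Q) c = zeroOn Q c := by
        funext a b
        unfold zeroOn
        by_cases h : (a, b) = p
        · subst h; simp [hcp]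
        · simp [Finset.mem_insert, h]
      rw [this]; exact ih
    · -- raise the entry `p` of `zeroOn (insert p Q) c` back to get `zeroOn Q c`
      have hraise := zeroOn_insert_eq_setCoupling Q c p
      have hδ : 0 ≤ zeroOn Q c p.1 p.2 := zeroOn_nonneg Q hc _ _
      have hlt : nnz (zeroOn (insert p Q) c) < nnz c := nnz_zeroOn_insert_lt hcp
      have hNG := hIH (zeroOn (insert p Q) c) (zeroOn_nonneg _ hc) hlt p.1 p.2
      have hpos' : ∀ θ ∈ Set.Ico (0 : ℝ) T, 0 < avg (setCoupling (zeroOn (insert p Q) c) p.1 p.2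
          (zeroOn (insert p Q) c p.1 p.2 + zeroOn Q c p.1 p.2))
          (fun ρ => Real.cos (θ * weightedMagnetization lam ρ)) := by
        rw [← hraise]; exact ih
      exact posUpTo_of_raise (zeroOn_nonneg _ hc) hlam hNG hδ hpos'

/-- `lamSub K lam` as an `if … ∈ Kᶜ`. [folklore] -/
theorem lamSub_eq (K : Finset ι) (lam : ι → ℝ) :
    lamSub K lam = fun a => if a ∈ Kᶜ then 0 else lam a := by
  funext a; unfold lamSub; by_cases h : a ∈ K <;> simp [h]

/-- Sites outside `K` are isolated in `cSub K c`. [folklore] -/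
theorem cSub_isolated (K : Finset ι) (c : ι → ι → ℝ) :
    ∀ x ∈ Kᶜ, ∀ y, cSub K c x y = 0 ∧ cSub K c y x = 0 := by
  intro x hx y
  have hx' : x ∉ K := by simpa using hx
  constructor
  · exact cSub_apply_of_not c fun h => hx' h.1
  · exact cSub_apply_of_not c fun h => hx' h.2

/-- **The sub-model keeps positivity** (`a₁(H[K]) ≥ a₁(H)`), given NG′ for all models with fewer
nonzero entries. [folklore] -/
theorem pos_sub_of_ng {c : ι → ι → ℝ} (hc : ∀ a b, 0 ≤ c a b) {lam : ι → ℝ} (hlam : ∀ a, 0 ≤ lam a)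
    (hIH : ∀ c'' : ι → ι → ℝ, (∀ a b, 0 ≤ c'' a b) → nnz c'' < nnz c → ∀ a b : ι,
      ∀ θ : ℝ, 0 < θ →
        (∀ θ' ∈ Set.Ico (0 : ℝ) θ, 0 < avg c'' (fun ρ => Real.cos (θ' * weightedMagnetization lam ρ))) →
        avg c'' (fun ρ => Real.cos (θ * weightedMagnetization lam ρ)) = 0 →
        avg c'' (fun ρ => spinAt a ρ * spinAt b ρ * Real.cos (θ * weightedMagnetization lam ρ)) ≤ 0)
    {T : ℝ} (hpos : ∀ θ ∈ Set.Ico (0 : ℝ) T, 0 < avg c (fun ρ => Real.cos (θ * weightedMagnetization lam ρ)))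
    (K : Finset ι) :
    ∀ θ ∈ Set.Ico (0 : ℝ) T,
      0 < avg (cSub K c) (fun ρ => Real.cos (θ * weightedMagnetization (lamSub K lam) ρ)) := by
  have h1 : ∀ θ ∈ Set.Ico (0 : ℝ) T,
      0 < avg (cSub K c) (fun ρ => Real.cos (θ * weightedMagnetization lam ρ)) := by
    rw [cSub_eq_zeroOn]
    exact pos_zeroOn_of_ng hc hlam hIH hpos _
  rw [lamSub_eq]
  exact pos_of_isolated_drop_set Kᶜ (cSub_isolated K c) h1

/-- **NG′ for all models from the random-current identity (RC)** (thm2_proof.md §4): strong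
induction on the number of nonzero coupling entries.  The hypothesis `hRC` is the identity
`S_{uvw} Z − N_{uv} S_w = Σ_{K,a} κ_{K,a} · S^{K}_a · Z_K` with `κ ≥ 0` independent of `θ`
(sub-models `cSub K c`, `lamSub K λ` on the same index type); each term is `≥ 0` up to the first
zero of the sub-model (`sum_spin_mul_sin_weight_nonneg`), which is not earlier than that of the
model (`pos_sub_of_ng`), so PAIR-DEC′ holds and NG′ follows (`avg_spin_pair_cos_nonpos_of_pairDec`).
[folklore] -/
theorem ng_all_of_rc
    (hRC : ∀ (c : ι → ι → ℝ) (lam : ι → ℝ) (u v w : ι), (∀ a b, 0 ≤ c a b) → (∀ a, 0 ≤ lam a) →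
      ∃ κ : Finset ι → ι → ℝ, (∀ K a, 0 ≤ κ K a) ∧ ∀ θ : ℝ,
        (∑ ρ : SpinConfig ι, spinAt u ρ * spinAt v ρ * spinAt w ρ *
              Real.sin (θ * weightedMagnetization lam ρ) * weight c ρ) *
            (∑ ρ : SpinConfig ι, Real.cos (θ * weightedMagnetization lam ρ) * weight c ρ) -
          (∑ ρ : SpinConfig ι, spinAt u ρ * spinAt v ρ *
              Real.cos (θ * weightedMagnetization lam ρ) * weight c ρ) *
            (∑ ρ : SpinConfig ι, spinAt w ρ * Real.sin (θ * weightedMagnetization lam ρ) * weight c ρ) =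
        ∑ K : Finset ι, ∑ a : ι, κ K a *
          ((∑ ρ : SpinConfig ι, spinAt a ρ *
              Real.sin (θ * weightedMagnetization (lamSub K lam) ρ) * weight (cSub K c) ρ) *
            (∑ ρ : SpinConfig ι,
              Real.cos (θ * weightedMagnetization (lamSub K lam) ρ) * weight (cSub K c) ρ)))
    (c : ι → ι → ℝ) (hc : ∀ a b, 0 ≤ c a b) (lam : ι → ℝ) (hlam : ∀ a, 0 ≤ lam a) (u v : ι) :
    ∀ θ : ℝ, 0 < θ →
      (∀ θ' ∈ Set.Ico (0 : ℝ) θ, 0 < avg c (fun ρ => Real.cos (θ' * weightedMagnetization lam ρ))) →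
      avg c (fun ρ => Real.cos (θ * weightedMagnetization lam ρ)) = 0 →
      avg c (fun ρ => spinAt u ρ * spinAt v ρ * Real.cos (θ * weightedMagnetization lam ρ)) ≤ 0 := by
  -- strong induction on `nnz c`
  suffices key : ∀ n : ℕ, ∀ c : ι → ι → ℝ, nnz c = n → (∀ a b, 0 ≤ c a b) → ∀ u v : ι,
      ∀ θ : ℝ, 0 < θ →
        (∀ θ' ∈ Set.Ico (0 : ℝ) θ, 0 < avg c (fun ρ => Real.cos (θ' * weightedMagnetization lam ρ))) →
        avg c (fun ρ => Real.cos (θ * weightedMagnetization lam ρ)) = 0 →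
        avg c (fun ρ => spinAt u ρ * spinAt v ρ * Real.cos (θ * weightedMagnetization lam ρ)) ≤ 0 from
    key (nnz c) c rfl hc u v
  intro n
  induction n using Nat.strong_induction_on with
  | _ n ihn =>
    intro c hcn hc u v θs hθs hposb hzs
    have hIH : ∀ c'' : ι → ι → ℝ, (∀ a b, 0 ≤ c'' a b) → nnz c'' < nnz c → ∀ a b : ι,
        ∀ θ : ℝ, 0 < θ →
          (∀ θ' ∈ Set.Ico (0 : ℝ) θ, 0 < avg c'' (fun ρ => Real.cos (θ' * weightedMagnetization lam ρ))) →
          avg c'' (fun ρ => Real.cos (θ * weightedMagnetization lam ρ)) = 0 →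
          avg c'' (fun ρ => spinAt a ρ * spinAt b ρ * Real.cos (θ * weightedMagnetization lam ρ)) ≤ 0 :=
      fun c'' hc'' hlt a b => ihn (nnz c'') (hcn ▸ hlt) c'' rfl hc'' a b
    refine avg_spin_pair_cos_nonpos_of_pairDec hlam hθs (fun x t ht0 ht1 => ?_) hposb hzs
    -- PAIR-DEC′ at `(u,v,x)` and `t < θs` from (RC) and positivity of the terms
    obtain ⟨κ, hκ, hid⟩ := hRC c lam u v x hc hlam
    rw [hid t]
    refine sum_nonneg fun K _ => sum_nonneg fun a _ => mul_nonneg (hκ K a) ?_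
    -- the sub-model on `K` is positive on `[0, θs)`
    have hposK := pos_sub_of_ng hc hlam hIH hposb K
    have hcK : ∀ a b, 0 ≤ cSub K c a b := cSub_nonneg K hc
    have hlamK : ∀ a, 0 ≤ lamSub K lam a := lamSub_nonneg K hlam
    have hWK : 0 < ∑ ρ : SpinConfig ι, weight (cSub K c) ρ := sum_weight_pos _
    have hZK : ∀ s ∈ Set.Icc (0 : ℝ) t, 0 < ∑ ρ : SpinConfig ι,
        Real.cos (s * weightedMagnetization (lamSub K lam) ρ) * weight (cSub K c) ρ := by
      intro s hs
      have h := hposK s ⟨hs.1, hs.2.trans_lt ht1⟩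
      rw [avg_def] at h
      exact (div_pos_iff_of_pos_right hWK).1 h
    have hS : 0 ≤ ∑ ρ : SpinConfig ι, spinAt a ρ *
        Real.sin (t * weightedMagnetization (lamSub K lam) ρ) * weight (cSub K c) ρ :=
      sum_spin_mul_sin_weight_nonneg hcK hlamK a ht0 hZK
    exact mul_nonneg hS (hZK t ⟨ht0, le_rfl⟩).le

/-- **CJN Theorem 2 from the random-current identity (RC).** [cite: CamiaJiangNewman2023, Thm 2] -/
theorem CamiaJiangNewman2023_thm2_of_rc
    (hRC : ∀ (ι : Type) [Fintype ι] [DecidableEq ι] (c : ι → ι → ℝ) (lam : ι → ℝ) (u v w : ι),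
      (∀ a b, 0 ≤ c a b) → (∀ a, 0 ≤ lam a) →
      ∃ κ : Finset ι → ι → ℝ, (∀ K a, 0 ≤ κ K a) ∧ ∀ θ : ℝ,
        (∑ ρ : SpinConfig ι, spinAt u ρ * spinAt v ρ * spinAt w ρ *
              Real.sin (θ * PairIsing.weightedMagnetization lam ρ) * PairIsing.weight c ρ) *
            (∑ ρ : SpinConfig ι, Real.cos (θ * PairIsing.weightedMagnetization lam ρ) * PairIsing.weight c ρ) -
          (∑ ρ : SpinConfig ι, spinAt u ρ * spinAt v ρ *
              Real.cos (θ * PairIsing.weightedMagnetization lam ρ) * PairIsing.weight c ρ) *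
            (∑ ρ : SpinConfig ι, spinAt w ρ *
              Real.sin (θ * PairIsing.weightedMagnetization lam ρ) * PairIsing.weight c ρ) =
        ∑ K : Finset ι, ∑ a : ι, κ K a *
          ((∑ ρ : SpinConfig ι, spinAt a ρ *
              Real.sin (θ * PairIsing.weightedMagnetization (PairIsing.lamSub K lam) ρ) *
                PairIsing.weight (PairIsing.cSub K c) ρ) *
            (∑ ρ : SpinConfig ι, Real.cos (θ * PairIsing.weightedMagnetization (PairIsing.lamSub K lam) ρ) *
              PairIsing.weight (PairIsing.cSub K c) ρ))) :
    CamiaJiangNewman2023_thm2 :=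
  CamiaJiangNewman2023_thm2_of_pinnedSign fun ι _ _ c lam u v θ hc hlam _huv hθ hposb hzs =>
    ng_all_of_rc (hRC ι) c hc lam hlam u v θ hθ hposb hzs

end Assembly2

end PairIsing

/-- **Camia–Jiang–Newman 2023, Theorem 2 (the Nishimori–Griffiths conjecture), proved**: for finite
ferromagnetic pair interactions `0 ≤ J ≤ J̃` and weights `λ ≥ 0`, every zero `h` of `⟨exp(h Σλ_jσ_j)⟩_J`
has a zero `h'` of `⟨exp(h Σλ_jσ_j)⟩_{J̃}` with `|h'| ≤ |h|` (the first Lee–Yang zero moves towards the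
origin).  Proof: the random-current identity for `⟨σ_uσ_v ; σ_w⟩` at imaginary fields
(`PairIsing.rc_imaginary_field`) fed into `PairIsing.CamiaJiangNewman2023_thm2_of_rc` (Lee–Yang
positivity of the pinned sine sums up to the first zero, induction on the number of nonzero
couplings, single-coupling step by the intermediate value theorem).  This is NOT the printed proof
(which goes through CJN Thm 1). [cite: CamiaJiangNewman2023, Thm 2] -/
theorem CamiaJiangNewman2023_thm2_holds : CamiaJiangNewman2023_thm2 :=
  PairIsing.CamiaJiangNewman2023_thm2_of_rc fun _ _ _ c lam u v w hc _ =>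
    PairIsing.rc_imaginary_field c lam u v w hc

end Literature.Probability.LatticeModels
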